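import Literature.AlgebraicGeometry.Resolution.QuadraticTransforms
import Mathlib.RingTheory.Valuation.LocalSubring
import Mathlib.RingTheory.IntegralClosure.IsIntegralClosure.Basic
import Mathlib.RingTheory.Polynomial.Basic
import Mathlib.Algebra.Polynomial.Lifts
import Mathlib.Algebra.Polynomial.EraseLead
import HarnessLib

/-!
# Valuations dominating a union of dominated normal local rings (Abhyankar 1956, Lemma 7)

Topic: `Literature/AlgebraicGeometry/Resolution`. The valuation-theoretic input of Abhyankar's
union lemma for quadratic transforms (`QuadraticTransforms.lean`, `AbhyankarQuadraticUnion`):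

* `mem_or_inv_mem_of_aeval_eq_zero` — **Seidenberg's lemma** (Kaplansky, *Commutative Rings*,
  Thm. 67; Zariski–Samuel II, VI §4): if `U ⊆ K` is a local subring integrally closed in the field
  `K` and `t ∈ K` is a root of a polynomial over `U` one of whose coefficients is a unit, then
  `t ∈ U` or `t⁻¹ ∈ U`. Proof by induction on the degree: if the leading coefficient `a` is a unit,
  `t` is integral; otherwise `at` is integral, hence in `U`, and either `at` is a unit (then
  `t⁻¹ = a/(at) ∈ U`) or the relation shortens.
* `exists_valuationSubring_dominates_residually_transcendental'` — for such `U` and `t` with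
  `t, t⁻¹ ∉ U`: the map `U[t] → κ(U)[X]`, `t ↦ X`, is a well-defined ring homomorphism (its
  kernel contains every relation of `t`, all of whose coefficients lie in `m_U` by Seidenberg's
  lemma); its kernel `Q` is a prime of `U[t]` over `m_U`, and a valuation ring `W` of `K` centred
  on `Q` (Chevalley) contains `t` and DOMINATES `U` with the residue of `t` TRANSCENDENTAL over
  `κ(U)`: every `p ∈ U[X]` with `w(p(t)) > 0` has all its coefficients in `m_U`
  (Abhyankar 1956, Lemma 7 = Abhyankar 1959, Prop. 4.1, for one ring).
* `exists_valuationSubring_dominates_of_chain'` — **Abhyankar's Lemma 7**: for a chain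
  `R₀ ⊆ R₁ ⊆ ⋯` of local subrings of `K`, each integrally closed in `K` and dominated by the
  next, and `t ∈ K` with `t, t⁻¹ ∉ ⋃ Rᵢ`, there is a valuation ring `W` of `K` dominating every
  `Rᵢ`, containing `t`, such that for every `i` and `p ∈ Rᵢ[X]` with `w(p(t)) > 0` no coefficient
  of `p` is a unit ("`W` has centre `mᵢ` in `Rᵢ` and positive `Rᵢ`-dimension for each `i`").
  Proof: `U = ⋃ Rᵢ` is a local subring integrally closed in `K` with `m_U ∩ Rᵢ = mᵢ`; apply the
  previous result. (Unprimed names: the same without `t ∈ W`, as first landed.)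

Mathlib supplies Chevalley's extension theorem in the form "every local subring is dominated by
a valuation subring" (`LocalSubring.exists_le_valuationSubring`) and localisation of a subring at
a prime as a local subring (`LocalSubring.ofPrime`). No new definitions.

## Sources

* S. S. Abhyankar, *On the valuations centered in a local domain*, Amer. J. Math. 78 (1956),
  Lemma 7 (statement as reported in Huneke–Swanson, *Integral closure of ideals, rings, and
  modules*, Exercise 6.24). [cite: Abhyankar1956Valuations, Lemma 7]
* S. S. Abhyankar, *Ramification theoretic methods in algebraic geometry*, Princeton 1959,
  Prop. 4.1 and its proof (pp. 76–77). [cite: Abhyankar1959, Prop. 4.1]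
* O. Zariski, P. Samuel, *Commutative Algebra* II, Ch. VI §4 (integrally closed local domains and
  valuation rings). [cite: ZariskiSamuel1960, VI §4]
-/

noncomputable section

namespace Literature.AlgebraicGeometry.Resolution

universe u

variable {K : Type u} [Field K]

open IsLocalRing Polynomial

/-! ## Seidenberg's lemma -/

/-- **Seidenberg's lemma** (Kaplansky Thm. 67): `U ⊆ K` a local subring integrally closed in `K`,
`t ∈ K` a root of `p ∈ U[X]` with some unit coefficient; then `t ∈ U` or `t⁻¹ ∈ U`. (Stated
with a bound `n` on the degree, for the induction.) [cite: ZariskiSamuel1960, VI §4] -/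
theorem mem_or_inv_mem_of_aeval_eq_zero (U : Subring K) [IsLocalRing U] [IsIntegrallyClosedIn U K]
    {t : K} (n : ℕ) : ∀ p : U[X], p.natDegree ≤ n → aeval t p = 0 →
      (∃ i, IsUnit (p.coeff i)) → t ∈ U ∨ t⁻¹ ∈ U := by
  induction n with
  | zero =>
    rintro p hdeg hp ⟨i, hi⟩
    have hp0 : p = C (p.coeff 0) := eq_C_of_natDegree_le_zero hdeg
    have hi0 : i = 0 := by
      by_contra hne
      rw [hp0, coeff_C, if_neg hne] at hi
      exact not_isUnit_zero hi
    subst hi0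
    rw [hp0, aeval_C] at hp
    have h0 : p.coeff 0 = 0 := by
      apply Subtype.ext
      exact hp
    rw [h0] at hi
    exact absurd hi not_isUnit_zero
  | succ n ih =>
    rintro p hdeg hp hunit
    by_cases hle : p.natDegree ≤ n
    · exact ih p hle hp hunit
    by_cases ht0 : t = 0
    · exact Or.inl (ht0 ▸ U.zero_mem)
    have hdeg' : p.natDegree = n + 1 := by omega
    set a : U := p.leadingCoeff with ha
    have ha' : a = p.coeff (n + 1) := by rw [ha, leadingCoeff, hdeg']
    have hp0 : p ≠ 0 := by rintro rfl; simp at hdeg'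
    have ha0 : a ≠ 0 := leadingCoeff_ne_zero.mpr hp0
    have ha0' : (a : K) ≠ 0 := fun h => ha0 (Subtype.ext h)
    by_cases hau : IsUnit a
    · -- `t` is integral over `U`
      left
      obtain ⟨b, hb⟩ := hau.exists_right_inv
      have hmonic : (p * C b).Monic := monic_mul_C_of_leadingCoeff_mul_eq_one hb
      have hroot : aeval t (p * C b) = 0 := by rw [map_mul, hp, zero_mul]
      have hint : IsIntegral U t := ⟨p * C b, hmonic, hroot⟩
      obtain ⟨y, hy⟩ := IsIntegrallyClosedIn.algebraMap_eq_of_integral hint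
      rw [← hy]
      exact y.2
    · -- `a t` is integral over `U`, hence in `U`
      obtain ⟨y, hy⟩ :=
        IsIntegrallyClosedIn.algebraMap_eq_of_integral (isIntegral_leadingCoeff_smul p t hp)
      rw [Algebra.smul_def] at hy
      change (y : K) = (a : K) * t at hy
      by_cases hyu : IsUnit y
      · -- `t⁻¹ = a / (a t) ∈ U`
        right
        obtain ⟨hy0, hyinv⟩ := (isUnit_subring_iff_inv_mem y).mp hyu
        have : t⁻¹ = (a : K) * (y : K)⁻¹ := by
          rw [hy, mul_inv, ← mul_assoc, mul_inv_cancel₀ ha0', one_mul]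
        rw [this]
        exact U.mul_mem a.2 hyinv
      · -- shorten the relation: `q = (p - a X^(n+1)) + (a t) X^n`
        have hym : y ∈ maximalIdeal U := by
          rwa [mem_maximalIdeal, mem_nonunits_iff]
        set q : U[X] := p.eraseLead + C y * X ^ n with hq
        have hqdeg : q.natDegree ≤ n := by
          refine (natDegree_add_le _ _).trans (max_le ?_ (natDegree_C_mul_X_pow_le y n))
          have := eraseLead_natDegree_le p
          omega
        have hqroot : aeval t q = 0 := by
          have h1 : aeval t p.eraseLead = -((a : K) * t ^ (n + 1)) := by
            have := congrArg (aeval t) (eraseLead_add_C_mul_X_pow p)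
            rw [map_add, hp, map_mul, map_pow, aeval_C, aeval_X, hdeg'] at this
            rw [← ha] at this
            exact eq_neg_of_add_eq_zero_left this
          rw [hq, map_add, h1, map_mul, map_pow, aeval_C, aeval_X]
          change -((a : K) * t ^ (n + 1)) + (y : K) * t ^ n = 0
          rw [hy]; ring
        have hqunit : ∃ i, IsUnit (q.coeff i) := by
          obtain ⟨i, hi⟩ := hunit
          have hin : i ≠ n + 1 := by
            rintro rfl
            rw [← ha'] at hi
            exact hau hi
          have hile : i ≤ n := by
            by_contra hlt
            have : p.coeff i = 0 := coeff_eq_zero_of_natDegree_lt (by omega)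
            rw [this] at hi
            exact not_isUnit_zero hi
          refine ⟨i, ?_⟩
          have hci : q.coeff i = p.coeff i + (if i = n then y else 0) := by
            rw [hq, coeff_add, eraseLead_coeff_of_ne _ (by omega), coeff_C_mul_X_pow]
          rw [hci]
          split_ifs with hin'
          · -- unit + element of the maximal ideal is a unit
            by_contra hnu
            have hmem : p.coeff i + y ∈ maximalIdeal U := by
              rwa [mem_maximalIdeal, mem_nonunits_iff]
            have : p.coeff i ∈ maximalIdeal U := by
              have := (maximalIdeal U).sub_mem hmem hym
              rwa [add_sub_cancel_right] at this
            rw [mem_maximalIdeal, mem_nonunits_iff] at this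
            exact this hi
          · rwa [add_zero]
        exact ih q hqdeg hqroot hqunit

/-- Seidenberg's lemma, contrapositive form used below: if `t, t⁻¹ ∉ U` then every polynomial
relation of `t` over `U` has all its coefficients in `m_U`. [cite: Abhyankar1959, Prop. 4.1] -/
theorem coeff_mem_maximalIdeal_of_aeval_eq_zero (U : Subring K) [IsLocalRing U]
    [IsIntegrallyClosedIn U K] {t : K} (ht : t ∉ U) (ht' : t⁻¹ ∉ U) (p : U[X])
    (hp : aeval t p = 0) (i : ℕ) : p.coeff i ∈ maximalIdeal U := by
  by_contra hi
  have hu : IsUnit (p.coeff i) := by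
    by_contra h
    exact hi (by rw [mem_maximalIdeal, mem_nonunits_iff]; exact h)
  rcases mem_or_inv_mem_of_aeval_eq_zero U p.natDegree p le_rfl hp ⟨i, hu⟩ with h | h
  · exact ht h
  · exact ht' h

/-! ## A valuation dominating `U` with `t` residually transcendental -/

/-- **Abhyankar 1956, Lemma 7 (one ring)** = Abhyankar 1959, Prop. 4.1: let `U ⊆ K` be a local
subring integrally closed in the field `K` and `t ∈ K` with `t ∉ U`, `t⁻¹ ∉ U`. Then there is a
valuation ring `W` of `K` containing `t` and DOMINATING `U` such that the residue of `t` in `κ(W)`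
is transcendental over `κ(U)`: for every `p ∈ U[X]`, if `w(p(t)) > 0` (`W.valuation (p(t)) < 1`)
then all coefficients of `p` lie in `m_U`. Proof as printed: `H : U[t] → κ(U)[X]`, `t ↦ X`, is
well defined (Seidenberg's lemma), its kernel `Q` is a prime of `U[t]`, and `W` is a valuation
ring centred on `Q` (Chevalley; Mathlib `LocalSubring.exists_le_valuationSubring` applied to
`U[t]_Q`). [cite: Abhyankar1956Valuations, Lemma 7] [cite: Abhyankar1959, Prop. 4.1] -/
theorem exists_valuationSubring_dominates_residually_transcendental' (U : Subring K)
    [IsLocalRing U] [IsIntegrallyClosedIn U K] {t : K} (ht : t ∉ U) (ht' : t⁻¹ ∉ U) :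
    ∃ W : ValuationSubring K, t ∈ W ∧ SubringDominates U W.toSubring ∧
      ∀ p : U[X], W.valuation (aeval t p) < 1 → ∀ i, p.coeff i ∈ maximalIdeal U := by
  classical
  -- `ev : U[X] → K`, `B = U[t]`, `ρ : U[X] → κ(U)[X]`
  set ev : U[X] →+* K := (aeval (R := U) t).toRingHom with hev
  have hev_apply : ∀ p : U[X], ev p = aeval t p := fun p => rfl
  set B : Subring K := ev.range with hB
  set ev' : U[X] →+* B := ev.rangeRestrict with hev'
  have hsurj : Function.Surjective ev' := RingHom.rangeRestrict_surjective ev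
  have hev'_val : ∀ p : U[X], ((ev' p : B) : K) = aeval t p := fun p => rfl
  set ρ : U[X] →+* (ResidueField U)[X] := mapRingHom (residue U) with hρ
  have hker : RingHom.ker ev' ≤ RingHom.ker ρ := by
    intro p hp
    rw [RingHom.mem_ker] at hp ⊢
    have hp' : aeval t p = 0 := by
      have := congrArg (fun b : B => (b : K)) hp
      simpa [hev'_val] using this
    ext i
    rw [hρ, coe_mapRingHom, coeff_map, coeff_zero, residue_eq_zero_iff]
    exact coeff_mem_maximalIdeal_of_aeval_eq_zero U ht ht' p hp' i
  -- `H : B → κ(U)[X]` with `H ∘ ev' = ρ`; `Q = ker H` is prime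
  set H : B →+* (ResidueField U)[X] := ev'.liftOfSurjective hsurj ⟨ρ, hker⟩ with hH
  have hHev' : ∀ p : U[X], H (ev' p) = ρ p := fun p =>
    ev'.liftOfSurjective_comp_apply hsurj ⟨ρ, hker⟩ p
  set Q : Ideal B := RingHom.ker H with hQ
  haveI hQprime : Q.IsPrime := RingHom.ker_isPrime H
  -- a valuation ring centred on `Q`
  obtain ⟨W, hW⟩ := (LocalSubring.ofPrime B Q).exists_le_valuationSubring
  obtain ⟨hBQW, hlocal⟩ := LocalSubring.le_def.mp hW
  have hBW : B ≤ W.toSubring := (LocalSubring.le_ofPrime B Q).trans hBQW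
  have hUB : U ≤ B := fun x hx => ⟨C ⟨x, hx⟩, by rw [hev_apply, aeval_C]; rfl⟩
  -- elements of `Q` are non-units of `W`; elements of `B ∖ Q` are units of `W`
  have hQW : ∀ b : B, b ∈ Q → W.valuation (b : K) < 1 := by
    intro b hb
    have h1 : algebraMap B (LocalSubring.ofPrime B Q).toSubring b ∈
        maximalIdeal (LocalSubring.ofPrime B Q).toSubring :=
      (IsLocalization.AtPrime.to_map_mem_maximal_iff _ Q b).mpr hb
    have h2 : ¬ IsUnit (algebraMap B (LocalSubring.ofPrime B Q).toSubring b) := by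
      rw [mem_maximalIdeal, mem_nonunits_iff] at h1
      exact h1
    have h3 : ¬ IsUnit (Subring.inclusion hBQW
        (algebraMap B (LocalSubring.ofPrime B Q).toSubring b)) :=
      fun hu => h2 (hlocal.map_nonunit _ hu)
    have h4 : (⟨(b : K), hBW b.2⟩ : W) ∈ maximalIdeal W := by
      rw [mem_maximalIdeal, mem_nonunits_iff]
      exact h3
    exact (W.valuation_lt_one_iff _).mp h4
  have hQW' : ∀ b : B, b ∉ Q → W.valuation (b : K) = 1 := by
    intro b hb
    have h1 : IsUnit (algebraMap B (LocalSubring.ofPrime B Q).toSubring b) :=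
      IsLocalization.map_units _ (⟨b, hb⟩ : Q.primeCompl)
    have h2 : IsUnit (Subring.inclusion hBQW
        (algebraMap B (LocalSubring.ofPrime B Q).toSubring b)) := h1.map _
    have h3 : IsUnit (⟨(b : K), hBW b.2⟩ : W) := h2
    exact (W.valuation_eq_one_iff _).mp h3
  have htB : t ∈ B := ⟨X, by rw [hev_apply, aeval_X]⟩
  refine ⟨W, hBW htB, ⟨hUB.trans hBW, fun x hx hxW => ?_⟩, fun p hp i => ?_⟩
  · -- domination: a non-unit of `U` lies in `Q`, hence is a non-unit of `W`
    by_cases hx0 : x = 0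
    · rw [hx0, inv_zero]; exact U.zero_mem
    by_contra hxinv
    have hxm : (⟨x, hx⟩ : U) ∈ maximalIdeal U := by
      rw [mem_maximalIdeal_iff_inv_not_mem]
      exact Or.inr hxinv
    have hxQ : (⟨x, hUB hx⟩ : B) ∈ Q := by
      have hxe : (⟨x, hUB hx⟩ : B) = ev' (C ⟨x, hx⟩) := by
        apply Subtype.ext
        rw [hev'_val, aeval_C]
        rfl
      rw [hQ, RingHom.mem_ker, hxe, hHev', hρ, coe_mapRingHom, map_C, (residue_eq_zero_iff _).mpr hxm,
        map_zero]
    have hlt := hQW _ hxQ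
    have h1 : W.valuation x⁻¹ ≤ 1 := (W.valuation_le_one_iff _).mpr hxW
    rw [map_inv₀, inv_le_one₀ (pos_iff_ne_zero.mpr ((_root_.map_ne_zero _).mpr hx0))] at h1
    exact not_lt_of_ge h1 hlt
  · -- transcendence: `p(t) ∈ m_W ∩ B = Q`, so `ρ p = H (p(t)) = 0`
    have hpQ : ev' p ∈ Q := by
      by_contra hnot
      have := hQW' _ hnot
      rw [hev'_val] at this
      exact (ne_of_lt hp) this
    have hρp : ρ p = 0 := by
      rw [← hHev']
      exact hpQ
    have := congrArg (fun q => coeff q i) hρp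
    simp only [hρ, coe_mapRingHom, coeff_map, coeff_zero] at this
    exact (residue_eq_zero_iff _).mp this

/-- `exists_valuationSubring_dominates_residually_transcendental'` without recording `t ∈ W`
(the form first landed). [cite: Abhyankar1956Valuations, Lemma 7] [cite: Abhyankar1959, Prop. 4.1] -/
theorem exists_valuationSubring_dominates_residually_transcendental (U : Subring K)
    [IsLocalRing U] [IsIntegrallyClosedIn U K] {t : K} (ht : t ∉ U) (ht' : t⁻¹ ∉ U) :
    ∃ W : ValuationSubring K, SubringDominates U W.toSubring ∧
      ∀ p : U[X], W.valuation (aeval t p) < 1 → ∀ i, p.coeff i ∈ maximalIdeal U := by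
  obtain ⟨W, -, h₁, h₂⟩ := exists_valuationSubring_dominates_residually_transcendental' U ht ht'
  exact ⟨W, h₁, h₂⟩

/-! ## Unions of dominated normal local rings (Abhyankar's Lemma 7) -/

/-- **Abhyankar 1956, Lemma 7.** Let `R₀ ⊆ R₁ ⊆ ⋯` be local subrings of a field `K`, each
integrally closed in `K` and each dominated by the next (`m_{i+1} ∩ Rᵢ = mᵢ`), and let `t ∈ K`
with `t ∉ Rᵢ` and `t⁻¹ ∉ Rᵢ` for all `i` (so that `⋃ Rᵢ` is not a valuation ring). Then there is
a valuation ring `W` of `K` containing `t` which dominates every `Rᵢ` and in whose residue field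
the residue of `t` is transcendental over every `κ(Rᵢ)`: for `p ∈ Rᵢ[X]` with `w(p(t)) > 0`, no coefficient of
`p` is a unit of `Rᵢ`. (Abhyankar: "there exist [infinitely many] valuations `w` of `K` which have
center `Mᵢ` in `Rᵢ` and for which `D_w` is of positive transcendence degree over `Rᵢ/Mᵢ` for each
`i`"; we produce one, which is what Lemma 12 consumes.) Proof: `U = ⋃ Rᵢ` is a local subring of
`K`, integrally closed in `K`, with `m_U ∩ Rᵢ = mᵢ`; apply
`exists_valuationSubring_dominates_residually_transcendental`.
[cite: Abhyankar1956Valuations, Lemma 7] [cite: Abhyankar1959, Prop. 4.1] -/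
theorem exists_valuationSubring_dominates_of_chain' (R : ℕ → Subring K)
    (hloc : ∀ i, IsLocalRing (R i)) (hdom : ∀ i, SubringDominates (R i) (R (i + 1)))
    (hint : ∀ i, IsIntegrallyClosedIn (R i) K) {t : K} (ht : ∀ i, t ∉ R i)
    (ht' : ∀ i, t⁻¹ ∉ R i) :
    ∃ W : ValuationSubring K, t ∈ W ∧ (∀ i, SubringDominates (R i) W.toSubring) ∧
      ∀ i (p : (R i)[X]), W.valuation (aeval t p) < 1 → ∀ j, ¬ IsUnit (p.coeff j) := by
  classical
  have hmono : Monotone R := monotone_nat_of_le_succ fun i => (hdom i).1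
  have hdom' : ∀ i j, i ≤ j → SubringDominates (R i) (R j) := by
    intro i j hij
    induction hij with
    | refl => exact SubringDominates.refl _
    | step _ ih => exact ih.trans (hdom _)
  -- the union `U`
  set U : Subring K := ⨆ i, R i with hU
  have hdir : Directed (· ≤ ·) R := hmono.directed_le
  have hmemU : ∀ x, x ∈ U ↔ ∃ i, x ∈ R i := fun x => Subring.mem_iSup_of_directed hdir
  have hRU : ∀ i, R i ≤ U := fun i => le_iSup R i
  -- inverses found in `U` are found in each `R i` containing the element
  have hinvU : ∀ i x, x ∈ R i → x⁻¹ ∈ U → x⁻¹ ∈ R i := by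
    intro i x hx hxU
    obtain ⟨j, hj⟩ := (hmemU _).mp hxU
    exact (hdom' i (max i j) (le_max_left i j)).2 x hx (hmono (le_max_right i j) hj)
  -- `U` is local
  haveI hUloc : IsLocalRing U := by
    refine IsLocalRing.of_nonunits_add ?_
    intro a b ha hb
    rw [mem_nonunits_iff] at ha hb ⊢
    intro hab
    obtain ⟨hab0, habinv⟩ := (isUnit_subring_iff_inv_mem _).mp hab
    obtain ⟨i, hi⟩ := (hmemU _).mp a.2
    obtain ⟨j, hj⟩ := (hmemU _).mp b.2
    set k := max i j
    have hak : (a : K) ∈ R k := hmono (le_max_left i j) hi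
    have hbk : (b : K) ∈ R k := hmono (le_max_right i j) hj
    haveI := hloc k
    have habk : IsUnit (⟨(a : K) + b, (R k).add_mem hak hbk⟩ : R k) := by
      rw [isUnit_subring_iff_inv_mem]
      exact ⟨hab0, hinvU k _ ((R k).add_mem hak hbk) habinv⟩
    have habk' : (⟨(a : K) + b, (R k).add_mem hak hbk⟩ : R k) = ⟨a, hak⟩ + ⟨b, hbk⟩ := rfl
    rw [habk'] at habk
    rcases IsLocalRing.isUnit_or_isUnit_of_isUnit_add habk with hu | hu
    · obtain ⟨h0, hinv⟩ := (isUnit_subring_iff_inv_mem _).mp hu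
      exact ha ((isUnit_subring_iff_inv_mem _).mpr ⟨h0, hRU k hinv⟩)
    · obtain ⟨h0, hinv⟩ := (isUnit_subring_iff_inv_mem _).mp hu
      exact hb ((isUnit_subring_iff_inv_mem _).mpr ⟨h0, hRU k hinv⟩)
  -- `U` is integrally closed in `K`
  haveI hUint : IsIntegrallyClosedIn U K := by
    rw [Subring.isIntegrallyClosedIn_iff]
    rintro x ⟨p, hpm, hpx⟩
    -- all coefficients of `p` lie in some `R i`
    have hcoef : ∀ n, ∃ i, ((p.coeff n : U) : K) ∈ R i := fun n => (hmemU _).mp (p.coeff n).2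
    choose ι hι using hcoef
    set i : ℕ := p.support.sup ι with hi
    have hιi : ∀ n ∈ p.support, ((p.coeff n : U) : K) ∈ R i := fun n hn =>
      hmono (Finset.le_sup hn) (hι n)
    set φ : R i →+* U := Subring.inclusion (hRU i) with hφ
    have hlifts : p ∈ Polynomial.lifts φ := by
      rw [lifts_iff_coeff_lifts]
      intro n
      by_cases hn : n ∈ p.support
      · exact ⟨⟨(p.coeff n : K), hιi n hn⟩, Subtype.ext rfl⟩
      · rw [notMem_support_iff.mp hn]
        exact ⟨0, map_zero φ⟩
    obtain ⟨q, hqp, -, hqm⟩ := lifts_and_natDegree_eq_and_monic hlifts hpm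
    haveI := hloc i
    haveI := hint i
    have hqx : aeval x q = 0 := by
      rw [aeval_def, ← hpx, ← hqp, eval₂_map]
      rfl
    have hxint : IsIntegral (R i) x := ⟨q, hqm, hqx⟩
    obtain ⟨y, hy⟩ := IsIntegrallyClosedIn.algebraMap_eq_of_integral hxint
    rw [← hy]
    exact hRU i y.2
  have htU : t ∉ U := fun h => by
    obtain ⟨i, hi⟩ := (hmemU _).mp h
    exact ht i hi
  have htU' : t⁻¹ ∉ U := fun h => by
    obtain ⟨i, hi⟩ := (hmemU _).mp h
    exact ht' i hi
  obtain ⟨W, htW, hWU, htrans⟩ :=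
    exists_valuationSubring_dominates_residually_transcendental' U htU htU'
  refine ⟨W, htW, fun i => ⟨(hRU i).trans hWU.1, fun x hx hxW => hinvU i x hx (hWU.2 x (hRU i hx) hxW)⟩,
    fun i p hp j hu => ?_⟩
  -- transcendence over `R i`: map `p` to `U[X]`
  set φ : R i →+* U := Subring.inclusion (hRU i) with hφ
  have hmap : aeval t (p.map φ) = aeval t p := by
    rw [aeval_def, eval₂_map, aeval_def]
    rfl
  have hc := htrans (p.map φ) (by rwa [hmap]) j
  rw [coeff_map, mem_maximalIdeal, mem_nonunits_iff] at hc
  exact hc (hu.map φ)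

/-- `exists_valuationSubring_dominates_of_chain'` without recording `t ∈ W` (the form first
landed). [cite: Abhyankar1956Valuations, Lemma 7] [cite: Abhyankar1959, Prop. 4.1] -/
theorem exists_valuationSubring_dominates_of_chain (R : ℕ → Subring K)
    (hloc : ∀ i, IsLocalRing (R i)) (hdom : ∀ i, SubringDominates (R i) (R (i + 1)))
    (hint : ∀ i, IsIntegrallyClosedIn (R i) K) {t : K} (ht : ∀ i, t ∉ R i)
    (ht' : ∀ i, t⁻¹ ∉ R i) :
    ∃ W : ValuationSubring K, (∀ i, SubringDominates (R i) W.toSubring) ∧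
      ∀ i (p : (R i)[X]), W.valuation (aeval t p) < 1 → ∀ j, ¬ IsUnit (p.coeff j) := by
  obtain ⟨W, -, h₁, h₂⟩ := exists_valuationSubring_dominates_of_chain' R hloc hdom hint ht ht'
  exact ⟨W, h₁, h₂⟩

end Literature.AlgebraicGeometry.Resolution

end
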